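import Summits.QuantumFields.YangMills.Theorems.FluctuationComparisonRegPrIntLS2BetaAveragedBondStraightWord
import Summits.QuantumFields.YangMills.Theorems.FluctuationComparisonRegPrIntLS2BetaChartReadIterTranslate
import Summits.QuantumFields.YangMills.Theorems.FluctuationComparisonRegPrIntLS2BetaThinRectangleTransport
import Literature.MathematicalPhysics.QuantumFieldTheory.Balaban1983to89.T4UndoubledRP
import HarnessLib

/-!
# S2β · (REG-UP)′ bridge (O2-b3-β3a) — «THE AVERAGED RE-GAUGED TRANSLATE STAYS BONDWISE CLOSE TO THE AVERAGED BACKGROUND AT EVERY LEVEL»: the `η_i` letter of the `hLip` telescope —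
# `dist1 (Ū^i(h•τ_{L^k e_μ}U₀)(b) · Ū^i(U₀)(b)⁻¹) ≤ L^{k−i}·(2·ε_i + α_i)` (`i ≤ k ≤ m + K`), `ε_i` the line-vs-average letter of ✓(β1), `α_i` the plaquette class of `Ū^i U₀`

Cell `ym3-torus` (YM ladder rung R3 = continuum `SU(2)` Yang–Mills on the three-torus at fixed lattice data — a RUNG: NOT d = 4, NOT infinite volume, NOT a mass gap,
NOT Clay).  Width seat «width 12» `ym3-torus-px12` (gen 27); crux `stmt-QuantumFields-20520`, LINE g18-1 S2β, node (REG-UP)′ (hDcov assembly, `hLip` letter of ✓(O2-b3-α)).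
`--kind proof --supports stmt-QuantumFields-20520 --as helper`, count-neutral, DEFINITION-FREE (0 `def`, 0 `instance`, 0 `notation`, 0 `sorry`, default heartbeats).  Generic `P : Params`, `SU(N)`
with the printed `exp[mean log]` averaging.

THE MECHANISM.  Covariance and equivariance of the averaging (lit ✓`iter_gaugeAct`, ✓p840185 `iter_blockAvg_translate`) give EXACTLY `Ū^i(h•τ_T U₀) = (h_i)•τ_{v_i}(Ū^i U₀)` with
`h_i = transfUp h i = (z ↦ U₀[ι_i z, ι_i z + L^k e_μ])` (✓(β1) `transfUp_rowProd`) and `v_i = L^{k−i} e_μ` (`scaleTo i v_i = L^k e_μ`, lit ✓`scaleTo_update`).  Replacing the FINE straight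
transport `h_i` by the level-`i` straight transport `g_i z := (Ū^iU₀)[z, z + L^{k−i}e_μ]` costs `2·L^{k−i}·ε_i` (✓(β1) `dist1_rowProd_iter_mul_inv_le`, both ends of the bond, three-factor rule),
and `(g_i•τ_{v_i} Ū^iU₀)(b)·(Ū^iU₀)(b)⁻¹` is the thin rectangle `R_{L^{k−i}×1}` of `Ū^iU₀` (✓p840269 at level `i`: `≤ L^{k−i}·α_i`).

WHAT IS PROVED (sorry-free).  §1 `add_update_zero_eq_shiftN` (`x + n e_μ = shiftN x μ n`), `scaleTo_update_pow_sub` (`scaleTo i (L^{k−i} e_μ) = scaleTo k e_μ`, `i ≤ k`),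
`iter_regaugedTranslate_eq` (the exact identity), `dist1_conj_mul_le` (the three-factor rule for `h₋·W·h₊⁻¹·U⁻¹`);
§2 ★★★**`dist1_iter_regaugedTranslate_mul_inv_le`** — under ✓(β1)'s loop guards `θ` and recursion `ε` below `i`, and the plaquette class `dist1 (Ū^iU₀)(∂q) ≤ α_i` (`0 ≤ α_i`):
**`dist1 (Ū^i(h•τU₀)(b)·(Ū^iU₀)(b)⁻¹) ≤ (L^{k−i} : ℕ)·(2·ε i + α_i)`** for every `b : PBond P i` (`i ≤ k ≤ m + K`); ★★`norm_coe_iter_regaugedTranslate_sub_le` — the same as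
**`‖↑(Ū^i(h•τU₀)(b)) − ↑(Ū^iU₀(b))‖ ≤ L^{k−i}·(2ε_i + α_i)`**, the `hη` letter of ✓(β2) `norm_fderiv_chartRead_sub_fderiv_le_of_plaqSmall` at level `i` (globally in `b`, a fortiori locally).

HONEST SCOPE.  Group algebra on the torus over landed letters; nothing of Bałaban's renormalisation-group analysis proved ([Balaban1985Averaging] (9), (11), (19) pp.19–21; [Balaban1987RG1] (0.4),
(2.17)); the telescope instantiation (β3-b), (hNL)∕(REG-UP)′∕GAP♯∘ (`stub_uniformFibreGapOrbit`, registry 3732b7df UNTOUCHED, 0∕5), the five registered stubs, S2β, crux 20520, 19936, 19200,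
`YM3TorusSU2` — NOT proved; rung R3 — NOT d = 4, NOT infinite volume, NOT a mass gap, NOT Clay; the Yang–Mills mass gap is NOT proved.
-/

set_option autoImplicit false

noncomputable section

open scoped Matrix.Norms.L2Operator

namespace Summit.QuantumFields.YangMills.Theorems.FluctuationComparisonRegPrIntLS2BetaRegaugedTranslateTower

open Literature.MathematicalPhysics.QuantumFieldTheory.Balaban1983to89
open Literature.MathematicalPhysics.QuantumFieldTheory.Balaban1983to89.BlockAveraging (Small Idx avgFun loopHol blockAvg blockAvg_avg)
open Literature.MathematicalPhysics.QuantumFieldTheory.Balaban1983to89.ExpMeanLog (expMeanLogSU deltaSU)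
open Literature.MathematicalPhysics.QuantumFieldTheory.Balaban1983to89.T4Continuum (transfUp iter_gaugeAct)
open Literature.MathematicalPhysics.QuantumFieldTheory.Balaban1983to89.T4UndoubledRP (zero_shift_eq scaleTo_update)
open Literature.MathematicalPhysics.QuantumFieldTheory.Balaban1983to89.B10Eq47AxialChi (shiftN shiftN_zero shiftN_succ rowProd rowProd_zero rowProd_succ rect)
open Literature.MathematicalPhysics.QuantumFieldTheory.Balaban1983to89.B15DeterminingSets (embIter)
open Summit.QuantumFields.YangMills.Theorems.AvgActionDefect (shiftN_apply)
open Summit.QuantumFields.YangMills.Theorems.FluctuationComparisonRegPrIntLS2BetaChartReadIterTranslate (iter_blockAvg_translate)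
open Summit.QuantumFields.YangMills.Theorems.FluctuationComparisonRegPrIntLS2BetaThinRectangleTransport (translate_eq_shiftN dist1_gaugeAct_rowProd_shift_mul_inv_le)
open Summit.QuantumFields.YangMills.Theorems.FluctuationComparisonRegPrIntLS2BetaAveragedBondStraightWord
  (dist1_mul_mul_mul_inv_le transfUp_rowProd dist1_rowProd_iter_mul_inv_le norm_coe_sub_coe_eq_dist1)

variable {P : Params}

/-! ## §1 Torus algebra and the exact identity -/

/-- `x + n·e_μ = shiftN x μ n` at any level. [folklore] -/
theorem add_update_zero_eq_shiftN {j : ℕ} (μ : Fin P.d) (n : ℕ) (x : Site P j) :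
    @HAdd.hAdd (Site P j) (Site P j) (Site P j) instHAdd x (Function.update (0 : Site P j) μ (n : ZMod (P.sitesPerDir j))) = shiftN x μ n := by
  funext ν
  rw [shiftN_apply, Site.add_apply]
  by_cases hν : ν = μ
  · subst hν
    rw [Function.update_self, if_pos rfl]
  · rw [Function.update_of_ne hν, if_neg hν, Site.zero_apply]

/-- `scaleTo i (L^{k−i}·e_μ) = scaleTo k e_μ` for `i ≤ k` (both are `L^k·e_μ` on the fine lattice). [cite: Balaban1987RG1, (0.1) p.252] -/
theorem scaleTo_update_pow_sub (μ : Fin P.d) {i k : ℕ} (hik : i ≤ k) :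
    Site.scaleTo i (Function.update (0 : Site P i) μ ((P.L ^ (k - i) : ℕ) : ZMod (P.sitesPerDir i))) = Site.scaleTo k ((0 : Site P k).shift μ) := by
  rw [zero_shift_eq, scaleTo_update, scaleTo_update, one_mul, ← pow_add, Nat.sub_add_cancel hik]

section Identity

variable {G : Type*} [GaugeGroup G]

/-- ★ **THE EXACT IDENTITY**: `Ū^i(h•τ_{L^k e_μ} U₀) = (h_i)•(b ↦ Ū^iU₀ ⟨shiftN b₋ μ L^{k−i}, b.dir⟩)` (`i ≤ k`, `i ≤ m + K`) — covariance ∘ equivariance of the averaging.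
[cite: Balaban1985Averaging, (11) p.19; Balaban1987RG1, (0.4) p.253, (2.17) p.269] -/
theorem iter_regaugedTranslate_eq (ℰ : LoopAverage G) (U₀ : GaugeField P 0 G) (h : GaugeTransf P 0 G) (μ : Fin P.d) {i k : ℕ} (hik : i ≤ k) (hi : i ≤ P.m + P.K) :
    Averaging.iter (fun j => blockAvg (P := P) (j := j) ℰ) i (GaugeField.gaugeAct h (U₀.translate (Site.scaleTo k ((0 : Site P k).shift μ)))) =
      GaugeField.gaugeAct (transfUp h i) (fun b' : PBond P i =>
        Averaging.iter (fun j => blockAvg (P := P) (j := j) ℰ) i U₀ ⟨shiftN b'.src μ (P.L ^ (k - i)), b'.dir⟩) := by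
  rw [iter_gaugeAct _ h i hi, ← scaleTo_update_pow_sub μ hik, iter_blockAvg_translate ℰ i _ U₀,
    translate_eq_shiftN _ _ μ (P.L ^ (k - i)) (add_update_zero_eq_shiftN μ (P.L ^ (k - i)))]

/-- The three-factor rule for a re-gauged bond: `dist1 (h₋·W·h₊⁻¹·U⁻¹) ≤ dist1 (h₋·g₋⁻¹) + dist1 (g₋·W·g₊⁻¹·U⁻¹) + dist1 (g₊·h₊⁻¹)`
(`h₋Wh₊⁻¹U⁻¹ = (h₋g₋⁻¹)·(g₋Wg₊⁻¹U⁻¹)·U(g₊h₊⁻¹)U⁻¹`). [folklore] -/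
theorem dist1_conj_mul_le (hs ht gs gt W U : G) :
    dist1 (hs * W * ht⁻¹ * U⁻¹) ≤ dist1 (hs * gs⁻¹) + dist1 (gs * W * gt⁻¹ * U⁻¹) + dist1 (gt * ht⁻¹) := by
  have hid : hs * W * ht⁻¹ * U⁻¹ = (hs * gs⁻¹) * (gs * W * gt⁻¹ * U⁻¹) * (U * (gt * ht⁻¹) * U⁻¹) := by group
  rw [hid]
  refine (GaugeGroup.dist1_mul_le _ _).trans ?_
  rw [GaugeGroup.dist1_conj]
  exact add_le_add (GaugeGroup.dist1_mul_le _ _) le_rfl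

end Identity

/-! ## §2 The `η_i` letter -/

section Eta

variable {N : ℕ} [NeZero N]

/-- ★★★ **THE `η_i` LETTER**: with `h x := U₀[x, x + L^k e_μ]` (`rowProd U₀ x μ L^k`), `U′ := h•τ_{L^k e_μ} U₀`, the (0.4) loop guards `θ` below `i`, ✓(β1)'s recursion
`ε 0 = 0`, `L·ε j + 2θ_j ≤ ε (j+1)` (`j < i`), and the plaquette class `dist1 (Ū^iU₀)(∂q) ≤ α_i` (`0 ≤ α_i`): for every `b : PBond P i` (`i ≤ k`, `i ≤ m + K`),
**`dist1 (Ū^i U′ (b) · (Ū^i U₀ (b))⁻¹) ≤ L^{k−i}·(2·ε i + α_i)`**. [cite: Balaban1985Averaging, (9), (11), (19) pp.19-21; Balaban1987RG1, (0.4) p.253; Balaban1985RegularSpaces, Lemma 1 p.79] -/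
theorem dist1_iter_regaugedTranslate_mul_inv_le (U₀ : GaugeField P 0 (Matrix.specialUnitaryGroup (Fin N) ℂ)) (μ : Fin P.d) {i k : ℕ} (hik : i ≤ k) (hi : i ≤ P.m + P.K)
    {θ ε : ℕ → ℝ} (hθδ : ∀ j, θ j < deltaSU (Fin N)) (hθ6 : ∀ j, θ j ≤ 1 / 6) (hε0 : ε 0 = 0)
    (hθ : ∀ j, j < i → ∀ (c : PBond P (j + 1)) (ι : Idx P),
      dist1 (loopHol (Averaging.iter (fun j => blockAvg (P := P) (j := j) (expMeanLogSU (n := Fin N))) j U₀) c ι) ≤ θ j)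
    (hε : ∀ j, j < i → (P.L : ℝ) * ε j + 2 * θ j ≤ ε (j + 1))
    {αi : ℝ} (hαi0 : 0 ≤ αi) (hαi : ∀ q : Plaq P i, dist1 (GaugeField.plaqHol (Averaging.iter (fun j => blockAvg (P := P) (j := j) (expMeanLogSU (n := Fin N))) i U₀) q) ≤ αi)
    (b : PBond P i) :
    dist1 (Averaging.iter (fun j => blockAvg (P := P) (j := j) (expMeanLogSU (n := Fin N))) i
          (GaugeField.gaugeAct (fun x : Site P 0 => rowProd U₀ x μ (P.L ^ k)) (U₀.translate (Site.scaleTo k ((0 : Site P k).shift μ)))) b *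
        (Averaging.iter (fun j => blockAvg (P := P) (j := j) (expMeanLogSU (n := Fin N))) i U₀ b)⁻¹) ≤
      ((P.L ^ (k - i) : ℕ) : ℝ) * (2 * ε i + αi) := by
  set W := Averaging.iter (fun j => blockAvg (P := P) (j := j) (expMeanLogSU (n := Fin N))) i U₀ with hW
  rw [iter_regaugedTranslate_eq (expMeanLogSU (n := Fin N)) U₀ _ μ hik hi]
  -- the re-gauged bond `h₋ · W(b + v) · h₊⁻¹`, `h_i = transfUp h i = rowProd U₀ (ι_i ·) μ L^k`
  show dist1 (transfUp (fun x : Site P 0 => rowProd U₀ x μ (P.L ^ k)) i b.src * W ⟨shiftN b.src μ (P.L ^ (k - i)), b.dir⟩ *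
      (transfUp (fun x : Site P 0 => rowProd U₀ x μ (P.L ^ k)) i b.tgt)⁻¹ * (W b)⁻¹) ≤ _
  rw [transfUp_rowProd, transfUp_rowProd]
  refine (dist1_conj_mul_le _ _ (rowProd W b.src μ (P.L ^ (k - i))) (rowProd W b.tgt μ (P.L ^ (k - i))) _ _).trans ?_
  -- the middle factor is the thin rectangle of ✓p840269 at level `i`
  have hmid : dist1 (rowProd W b.src μ (P.L ^ (k - i)) * W ⟨shiftN b.src μ (P.L ^ (k - i)), b.dir⟩ * (rowProd W b.tgt μ (P.L ^ (k - i)))⁻¹ * (W b)⁻¹) ≤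
      ((P.L ^ (k - i) : ℕ) : ℝ) * αi := by
    have h := dist1_gaugeAct_rowProd_shift_mul_inv_le W hαi0 hαi μ (P.L ^ (k - i)) b
    exact h
  -- the two end factors: fine straight transport vs level-`i` straight transport (✓(β1)), `L^{k−i}·L^i = L^k`
  have hpow : P.L ^ (k - i) * P.L ^ i = P.L ^ k := by rw [← pow_add, Nat.sub_add_cancel hik]
  have hend : ∀ z : Site P i, dist1 (rowProd U₀ (embIter i z) μ (P.L ^ k) * (rowProd W z μ (P.L ^ (k - i)))⁻¹) ≤ ((P.L ^ (k - i) : ℕ) : ℝ) * ε i := by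
    intro z
    have h := dist1_rowProd_iter_mul_inv_le U₀ μ hθδ hθ6 hε0 i hi hθ hε (P.L ^ (k - i)) z
    rw [hpow, ← hW] at h
    rw [← GaugeGroup.dist1_inv, mul_inv_rev, inv_inv]
    exact h
  have hend' : ∀ z : Site P i, dist1 (rowProd W z μ (P.L ^ (k - i)) * (rowProd U₀ (embIter i z) μ (P.L ^ k))⁻¹) ≤ ((P.L ^ (k - i) : ℕ) : ℝ) * ε i := by
    intro z
    have h := dist1_rowProd_iter_mul_inv_le U₀ μ hθδ hθ6 hε0 i hi hθ hε (P.L ^ (k - i)) z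
    rw [hpow, ← hW] at h
    exact h
  have h1 := hend b.src
  have h3 := hend' b.tgt
  nlinarith [h1, hmid, h3]

/-- ★★ **THE `hη` LETTER OF ✓(β2) AT LEVEL `i`, NORM FORM**: `‖↑(Ū^i U′ (b)) − ↑(Ū^i U₀ (b))‖ ≤ L^{k−i}·(2·ε i + α_i)` (globally in `b`). [cite: Balaban1985Averaging, (9), (11), (19) pp.19-21; Balaban1987RG1, (0.4) p.253] -/
theorem norm_coe_iter_regaugedTranslate_sub_le (U₀ : GaugeField P 0 (Matrix.specialUnitaryGroup (Fin N) ℂ)) (μ : Fin P.d) {i k : ℕ} (hik : i ≤ k) (hi : i ≤ P.m + P.K)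
    {θ ε : ℕ → ℝ} (hθδ : ∀ j, θ j < deltaSU (Fin N)) (hθ6 : ∀ j, θ j ≤ 1 / 6) (hε0 : ε 0 = 0)
    (hθ : ∀ j, j < i → ∀ (c : PBond P (j + 1)) (ι : Idx P),
      dist1 (loopHol (Averaging.iter (fun j => blockAvg (P := P) (j := j) (expMeanLogSU (n := Fin N))) j U₀) c ι) ≤ θ j)
    (hε : ∀ j, j < i → (P.L : ℝ) * ε j + 2 * θ j ≤ ε (j + 1))
    {αi : ℝ} (hαi0 : 0 ≤ αi) (hαi : ∀ q : Plaq P i, dist1 (GaugeField.plaqHol (Averaging.iter (fun j => blockAvg (P := P) (j := j) (expMeanLogSU (n := Fin N))) i U₀) q) ≤ αi)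
    (b : PBond P i) :
    ‖((Averaging.iter (fun j => blockAvg (P := P) (j := j) (expMeanLogSU (n := Fin N))) i
          (GaugeField.gaugeAct (fun x : Site P 0 => rowProd U₀ x μ (P.L ^ k)) (U₀.translate (Site.scaleTo k ((0 : Site P k).shift μ)))) b :
          Matrix.specialUnitaryGroup (Fin N) ℂ) : Matrix (Fin N) (Fin N) ℂ) -
        ((Averaging.iter (fun j => blockAvg (P := P) (j := j) (expMeanLogSU (n := Fin N))) i U₀ b : Matrix.specialUnitaryGroup (Fin N) ℂ) : Matrix (Fin N) (Fin N) ℂ)‖ ≤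
      ((P.L ^ (k - i) : ℕ) : ℝ) * (2 * ε i + αi) := by
  rw [norm_coe_sub_coe_eq_dist1]
  exact dist1_iter_regaugedTranslate_mul_inv_le U₀ μ hik hi hθδ hθ6 hε0 hθ hε hαi0 hαi b

end Eta

end Summit.QuantumFields.YangMills.Theorems.FluctuationComparisonRegPrIntLS2BetaRegaugedTranslateTower

end
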